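import Mathlib
import Summits.NavierStokesRegularity.NavierStokesRegularity.Theorems.FilamentSkeletonRssSkeletonJ1RMismatchTools
import Summits.NavierStokesRegularity.NavierStokesRegularity.Theorems.FilamentSkeletonRssSkeletonJ1RLiaSelfWindow
import Summits.NavierStokesRegularity.NavierStokesRegularity.Theorems.FilamentSkeletonRssMatchedKernelDirectionalDeriv

/-!
# Crux `SkeletonJ1R` (stmt-NavierStokesRegularity-23610) · line `streamline_kantorovich_R` · toward stub F2-d (`LiaDefectDerivBL`, v7), first brick for B1′:
# THE SELF-STRAND DERIVATIVE IN SYMMETRIZED (DIFFERENCE) FORM — `∫ ∂_σ f dσ = 0` along the filament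

Hand `leafhand-ns-filamentskeletonrs-1` (gen 0), `--supports stmt-NavierStokesRegularity-23610 --as helper`.  MODEL rung, NEGATIVE side of the ladder:
kernel calculus for a HYPOTHETICAL filament-type blow-up skeleton; nothing here is a claim about Navier–Stokes regularity; the stub and the crux stay OPEN.

After B2′ (`…LiaDefectDerivPartner.liaDefectDerivBL_of_self_deriv_bound`) the stub F2-d hinges on the SELF-strand derivative bound B1′, whose integrand
is the fixed-`σ` derivative kernel `G(Xτ − Xσ, X′σ, X′τ) = (−3⟪Xτ−Xσ, X′τ⟫K₅)•X′σ×(Xτ−Xσ) + K₃•X′σ×X′τ` — NOT small pointwise (it is the derivative of a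
nearly singular kernel).  The smallness of `Ȧ_j` is visible only after adding the total `σ`-derivative of the self-strand integrand
`f(σ) = K₃(Xτ − Xσ)•X′σ×(Xτ − Xσ)`, which integrates to zero: the symmetrized integrand
`G + ∂_σ f = (−3⟪Xτ−Xσ, X′τ − X′σ⟫K₅)•X′σ×(Xτ−Xσ) + K₃•[X′σ×(X′τ − X′σ) + X″σ×(Xτ−Xσ)]` involves only tangent DIFFERENCES and the curvature, i.e. it
is the derivative "in the shifted variable `s = σ − τ`", of size `O(κ′s² + κ²|s|³)·K` on the window — the form in which the local-induction asymptotics of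
`Ȧ_j` (`≈ Λ_e(R)·X′τ × X‴τ`) can be read off by the S1–S4 method of the F2-B chain.  This file proves the calculus:
* `hasDerivAt_selfIntegrand_param` — `∂_σ f` explicitly (chain rule for `K₃`, bilinearity of `×`);
* `norm_mul_kernel_three_le` — `‖w‖·((‖w‖²+q)^{3/2})⁻¹ ≤ (‖w‖²+q)⁻¹`;
* `integrable_selfIntegrand_deriv_param` — `∂_σ f` is integrable along a unit-speed `C²` curve with chord–arc constant `c` and bounded curvature
  (Cauchy majorant `(4/√q + M)/c² · ((√q/c)² + (σ−τ)²)⁻¹`);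
* `integral_selfIntegrand_deriv_param_eq_zero` — `∫ ∂_σ f dσ = 0` (Mathlib's `integral_eq_zero_of_hasDerivAt_of_integrable`, `f` integrable by the
  matched-kernel toolkit);
* `selfStrand_derivKernel_symm` — `∫ G dσ = ∫ (G + ∂_σ f) dσ` for every direction `P`.
-/

set_option linter.dupNamespace false -- `NavierStokesRegularity.NavierStokesRegularity` path/namespace repetition is the tree convention

noncomputable section

namespace Summit.NavierStokesRegularity.NavierStokesRegularity.Theorems.SkeletonJ1RFrame

open Set Function Filter Real Topology MeasureTheory
open Literature.Analysis.FluidPDE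
open Summit.NavierStokesRegularity.NavierStokesRegularity.Theorems.SkeletonJ1RMismatchTools (integral_inv_sq_add_sq integrable_inv_sq_add_sq)
open Summit.NavierStokesRegularity.NavierStokesRegularity.Theorems.SkeletonJ1RLiaSelf (continuous_deriv_two)
open Summit.NavierStokesRegularity.NavierStokesRegularity.Theorems.MatchedKernel (matchedBiotSavart_integrable matchedBiotSavart_directionalDeriv
  norm_deriv_integrand_le)
open scoped InnerProductSpace BigOperators

variable {X : ℝ → EuclideanSpace ℝ (Fin 3)}

/-! ## §1 The `σ`-derivative of the self-strand integrand -/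

/-- **`∂_σ [K₃(Xτ − Xσ) • X′σ × (Xτ − Xσ)]`**, explicitly (`C²` curve, core `q > 0`). [folklore] -/
theorem hasDerivAt_selfIntegrand_param {q : ℝ} (hq : 0 < q) (hX : ContDiff ℝ 2 X) (τ σ : ℝ) :
    HasDerivAt (fun σ' : ℝ => ((‖X τ - X σ'‖ ^ 2 + q) ^ (3 / 2 : ℝ))⁻¹ • cross (deriv X σ') (X τ - X σ'))
      ((-3 * ⟪X τ - X σ, -deriv X σ⟫_ℝ * ((‖X τ - X σ‖ ^ 2 + q) ^ (5 / 2 : ℝ))⁻¹) • cross (deriv X σ) (X τ - X σ) +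
        ((‖X τ - X σ‖ ^ 2 + q) ^ (3 / 2 : ℝ))⁻¹ • (cross (deriv X σ) (-deriv X σ) + cross (deriv (deriv X) σ) (X τ - X σ))) σ := by
  have hpos : ∀ z : EuclideanSpace ℝ (Fin 3), 0 < ‖z‖ ^ 2 + q := fun z => by positivity
  have hXd : HasDerivAt X (deriv X σ) σ := ((hX.differentiable (by norm_num)) σ).hasDerivAt
  have hw : HasDerivAt (fun σ' : ℝ => X τ - X σ') (-deriv X σ) σ := by
    have h := (hasDerivAt_const σ (X τ)).sub hXd
    rwa [zero_sub] at h
  have h1 : HasDerivAt (fun σ' : ℝ => ‖X τ - X σ'‖ ^ 2 + q) (2 * ⟪X τ - X σ, -deriv X σ⟫_ℝ) σ := hw.norm_sq.add_const q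
  have h2 := h1.rpow_const (p := -(3 / 2)) (Or.inl (hpos _).ne')
  have hk : HasDerivAt (fun σ' : ℝ => ((‖X τ - X σ'‖ ^ 2 + q) ^ (3 / 2 : ℝ))⁻¹)
      (-3 * ⟪X τ - X σ, -deriv X σ⟫_ℝ * ((‖X τ - X σ‖ ^ 2 + q) ^ (5 / 2 : ℝ))⁻¹) σ := by
    have hfun : (fun σ' : ℝ => ((‖X τ - X σ'‖ ^ 2 + q) ^ (3 / 2 : ℝ))⁻¹) = fun σ' => (‖X τ - X σ'‖ ^ 2 + q) ^ (-(3 / 2) : ℝ) := by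
      funext σ'; rw [Real.rpow_neg (hpos _).le]
    rw [hfun]
    refine h2.congr_deriv ?_
    rw [show (-(3 / 2) : ℝ) - 1 = -(5 / 2) by norm_num, Real.rpow_neg (hpos _).le]
    ring
  have hT : HasDerivAt (deriv X) (deriv (deriv X) σ) σ := (hX.differentiable_deriv_two σ).hasDerivAt
  have hc : HasDerivAt (fun σ' : ℝ => cross (deriv X σ') (X τ - X σ'))
      (cross (deriv X σ) (-deriv X σ) + cross (deriv (deriv X) σ) (X τ - X σ)) σ := by
    have h := crossCLM.hasDerivAt_of_bilinear (fun _ => hT) (fun _ => hw)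
    simpa only [crossCLM_apply] using h
  exact (hk.smul hc).congr_deriv (add_comm _ _)

/-! ## §2 Integrability of `∂_σ f` and the vanishing of its integral -/

/-- `‖w‖ · ((‖w‖² + q)^{3/2})⁻¹ ≤ (‖w‖² + q)⁻¹` (`q > 0`). [folklore] -/
theorem norm_mul_kernel_three_le {q : ℝ} (hq : 0 < q) (w : EuclideanSpace ℝ (Fin 3)) :
    ‖w‖ * ((‖w‖ ^ 2 + q) ^ (3 / 2 : ℝ))⁻¹ ≤ (‖w‖ ^ 2 + q)⁻¹ := by
  set s := ‖w‖ ^ 2 + q with hs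
  have hs0 : 0 < s := by positivity
  have h32 : s ^ (3 / 2 : ℝ) = s * Real.sqrt s := by
    rw [show (3 / 2 : ℝ) = 1 + 1 / 2 by norm_num, Real.rpow_add hs0, Real.rpow_one, Real.sqrt_eq_rpow]
  have hws : ‖w‖ ≤ Real.sqrt s := Real.le_sqrt_of_sq_le (by rw [hs]; linarith)
  have hsq0 : 0 < Real.sqrt s := Real.sqrt_pos.2 hs0
  rw [h32, mul_inv]
  calc ‖w‖ * (s⁻¹ * (Real.sqrt s)⁻¹) = s⁻¹ * (‖w‖ / Real.sqrt s) := by ring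
    _ ≤ s⁻¹ * 1 := by
        refine mul_le_mul_of_nonneg_left ?_ (inv_nonneg.2 hs0.le)
        exact (div_le_one hsq0).2 hws
    _ = s⁻¹ := mul_one _

/-- **`∂_σ f` is integrable** along a unit-speed `C²` curve with chord–arc constant `c > 0` and curvature `≤ M`. [folklore] -/
theorem integrable_selfIntegrand_deriv_param {q : ℝ} (hq : 0 < q) (hX : ContDiff ℝ 2 X) (hunit : ∀ s, ‖deriv X s‖ = 1) {c M : ℝ}
    (hc : 0 < c) (hchord : ∀ u v, c * |u - v| ≤ ‖X u - X v‖) (hM : ∀ s, ‖deriv (deriv X) s‖ ≤ M) (τ : ℝ) :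
    Integrable fun σ : ℝ => (-3 * ⟪X τ - X σ, -deriv X σ⟫_ℝ * ((‖X τ - X σ‖ ^ 2 + q) ^ (5 / 2 : ℝ))⁻¹) • cross (deriv X σ) (X τ - X σ) +
        ((‖X τ - X σ‖ ^ 2 + q) ^ (3 / 2 : ℝ))⁻¹ • (cross (deriv X σ) (-deriv X σ) + cross (deriv (deriv X) σ) (X τ - X σ)) := by
  have hM0 : 0 ≤ M := (norm_nonneg _).trans (hM 0)
  have hsq : 0 < Real.sqrt q := Real.sqrt_pos.2 hq
  set aq : ℝ := Real.sqrt q / c with haq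
  have haq0 : 0 < aq := by positivity
  set Kc : ℝ := (4 * (Real.sqrt q)⁻¹ + M) * (c ^ 2)⁻¹ with hKc
  have hKc0 : 0 ≤ Kc := by positivity
  -- continuity of the integrand
  have hXc : Continuous X := hX.continuous
  have hdc : Continuous (deriv X) := hX.continuous_deriv (by norm_num)
  have hd2c : Continuous (deriv (deriv X)) := continuous_deriv_two hX
  have hb : ∀ u : ℝ, 0 < ‖X τ - X u‖ ^ 2 + q := fun u => by positivity
  have hwc : Continuous fun u : ℝ => X τ - X u := continuous_const.sub hXc
  have hk3 : Continuous fun u : ℝ => ((‖X τ - X u‖ ^ 2 + q) ^ (3 / 2 : ℝ))⁻¹ :=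
    (((hwc.norm.pow 2).add continuous_const).rpow_const fun u => Or.inr (by norm_num)).inv₀ fun u => (Real.rpow_pos_of_pos (hb u) _).ne'
  have hk5 : Continuous fun u : ℝ => ((‖X τ - X u‖ ^ 2 + q) ^ (5 / 2 : ℝ))⁻¹ :=
    (((hwc.norm.pow 2).add continuous_const).rpow_const fun u => Or.inr (by norm_num)).inv₀ fun u => (Real.rpow_pos_of_pos (hb u) _).ne'
  have hcr1 : Continuous fun u : ℝ => cross (deriv X u) (X τ - X u) := (crossCLM.continuous.comp hdc).clm_apply hwc
  have hcr2 : Continuous fun u : ℝ => cross (deriv X u) (-deriv X u) := (crossCLM.continuous.comp hdc).clm_apply hdc.neg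
  have hcr3 : Continuous fun u : ℝ => cross (deriv (deriv X) u) (X τ - X u) := (crossCLM.continuous.comp hd2c).clm_apply hwc
  have hcont : Continuous fun σ : ℝ => (-3 * ⟪X τ - X σ, -deriv X σ⟫_ℝ * ((‖X τ - X σ‖ ^ 2 + q) ^ (5 / 2 : ℝ))⁻¹) •
        cross (deriv X σ) (X τ - X σ) +
      ((‖X τ - X σ‖ ^ 2 + q) ^ (3 / 2 : ℝ))⁻¹ • (cross (deriv X σ) (-deriv X σ) + cross (deriv (deriv X) σ) (X τ - X σ)) :=
    (((continuous_const.mul (hwc.inner hdc.neg)).mul hk5).smul hcr1).add (hk3.smul (hcr2.add hcr3))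
  -- the Cauchy majorant
  refine ((integrable_inv_sq_add_sq haq0 τ).const_mul Kc).mono' hcont.aestronglyMeasurable (Eventually.of_forall fun σ => ?_)
  set w := X τ - X σ with hw
  set s := ‖w‖ ^ 2 + q with hs
  have hs0 : 0 < s := by positivity
  -- the two pieces
  have h1 : ‖(-3 * ⟪w, -deriv X σ⟫_ℝ * ((‖w‖ ^ 2 + q) ^ (5 / 2 : ℝ))⁻¹) • cross (deriv X σ) w +
      ((‖w‖ ^ 2 + q) ^ (3 / 2 : ℝ))⁻¹ • cross (deriv X σ) (-deriv X σ)‖ ≤ 4 * (Real.sqrt q)⁻¹ * s⁻¹ := by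
    have h := norm_deriv_integrand_le hq (deriv X σ) w (-deriv X σ) (hunit σ).le
    rw [norm_neg, hunit σ, mul_one] at h
    exact h
  have h2 : ‖((‖w‖ ^ 2 + q) ^ (3 / 2 : ℝ))⁻¹ • cross (deriv (deriv X) σ) w‖ ≤ M * s⁻¹ := by
    have hk0 : 0 ≤ ((‖w‖ ^ 2 + q) ^ (3 / 2 : ℝ))⁻¹ := inv_nonneg.2 (Real.rpow_nonneg hs0.le _)
    rw [norm_smul, Real.norm_of_nonneg hk0]
    calc ((‖w‖ ^ 2 + q) ^ (3 / 2 : ℝ))⁻¹ * ‖cross (deriv (deriv X) σ) w‖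
        ≤ ((‖w‖ ^ 2 + q) ^ (3 / 2 : ℝ))⁻¹ * (‖deriv (deriv X) σ‖ * ‖w‖) :=
          mul_le_mul_of_nonneg_left (norm_cross_le_norm_mul_norm _ _) hk0
      _ ≤ ((‖w‖ ^ 2 + q) ^ (3 / 2 : ℝ))⁻¹ * (M * ‖w‖) := by gcongr; exact hM σ
      _ = M * (‖w‖ * ((‖w‖ ^ 2 + q) ^ (3 / 2 : ℝ))⁻¹) := by ring
      _ ≤ M * s⁻¹ := mul_le_mul_of_nonneg_left (norm_mul_kernel_three_le hq w) hM0
  -- s⁻¹ against the Cauchy kernel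
  have hsC : s⁻¹ ≤ (c ^ 2)⁻¹ * (aq ^ 2 + (σ - τ) ^ 2)⁻¹ := by
    have hch : c * |τ - σ| ≤ ‖w‖ := hchord τ σ
    have hch2 : c ^ 2 * (σ - τ) ^ 2 ≤ ‖w‖ ^ 2 := by
      have h0 : 0 ≤ c * |τ - σ| := by positivity
      have := pow_le_pow_left₀ h0 hch 2
      rw [mul_pow, sq_abs, show (τ - σ) ^ 2 = (σ - τ) ^ 2 by ring] at this
      exact this
    have hprod : c ^ 2 * (aq ^ 2 + (σ - τ) ^ 2) ≤ s := by
      have : c ^ 2 * aq ^ 2 = q := by rw [haq, div_pow, Real.sq_sqrt hq.le]; field_simp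
      rw [mul_add, this, hs]; linarith
    have hpos2 : 0 < c ^ 2 * (aq ^ 2 + (σ - τ) ^ 2) := by positivity
    rw [← mul_inv]
    exact inv_anti₀ hpos2 hprod
  -- assemble
  have hsplit : (-3 * ⟪w, -deriv X σ⟫_ℝ * ((‖w‖ ^ 2 + q) ^ (5 / 2 : ℝ))⁻¹) • cross (deriv X σ) w +
      ((‖w‖ ^ 2 + q) ^ (3 / 2 : ℝ))⁻¹ • (cross (deriv X σ) (-deriv X σ) + cross (deriv (deriv X) σ) w) =
      ((-3 * ⟪w, -deriv X σ⟫_ℝ * ((‖w‖ ^ 2 + q) ^ (5 / 2 : ℝ))⁻¹) • cross (deriv X σ) w +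
        ((‖w‖ ^ 2 + q) ^ (3 / 2 : ℝ))⁻¹ • cross (deriv X σ) (-deriv X σ)) +
      ((‖w‖ ^ 2 + q) ^ (3 / 2 : ℝ))⁻¹ • cross (deriv (deriv X) σ) w := by
    rw [smul_add]; abel
  rw [hsplit]
  calc _ ≤ ‖(-3 * ⟪w, -deriv X σ⟫_ℝ * ((‖w‖ ^ 2 + q) ^ (5 / 2 : ℝ))⁻¹) • cross (deriv X σ) w +
          ((‖w‖ ^ 2 + q) ^ (3 / 2 : ℝ))⁻¹ • cross (deriv X σ) (-deriv X σ)‖ +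
        ‖((‖w‖ ^ 2 + q) ^ (3 / 2 : ℝ))⁻¹ • cross (deriv (deriv X) σ) w‖ := norm_add_le _ _
    _ ≤ 4 * (Real.sqrt q)⁻¹ * s⁻¹ + M * s⁻¹ := add_le_add h1 h2
    _ = (4 * (Real.sqrt q)⁻¹ + M) * s⁻¹ := by ring
    _ ≤ (4 * (Real.sqrt q)⁻¹ + M) * ((c ^ 2)⁻¹ * (aq ^ 2 + (σ - τ) ^ 2)⁻¹) := mul_le_mul_of_nonneg_left hsC (by positivity)
    _ = Kc * (aq ^ 2 + (σ - τ) ^ 2)⁻¹ := by rw [hKc]; ring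

/-- **`∫ ∂_σ f dσ = 0`**: the self-strand integrand is integrable with integrable derivative along the filament. [folklore] -/
theorem integral_selfIntegrand_deriv_param_eq_zero {q : ℝ} (hq : 0 < q) (hX : ContDiff ℝ 2 X) (hunit : ∀ s, ‖deriv X s‖ = 1)
    {c M : ℝ} (hc : 0 < c) (hchord : ∀ u v, c * |u - v| ≤ ‖X u - X v‖) (hM : ∀ s, ‖deriv (deriv X) s‖ ≤ M) (τ : ℝ) :
    ∫ σ : ℝ, ((-3 * ⟪X τ - X σ, -deriv X σ⟫_ℝ * ((‖X τ - X σ‖ ^ 2 + q) ^ (5 / 2 : ℝ))⁻¹) • cross (deriv X σ) (X τ - X σ) +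
        ((‖X τ - X σ‖ ^ 2 + q) ^ (3 / 2 : ℝ))⁻¹ • (cross (deriv X σ) (-deriv X σ) + cross (deriv (deriv X) σ) (X τ - X σ))) = 0 := by
  have hXg : ∀ u, c * |u| - ‖X 0‖ ≤ ‖X u‖ := fun u => by
    have h := hchord u 0
    rw [sub_zero] at h
    have h2 : ‖X u - X 0‖ ≤ ‖X u‖ + ‖X 0‖ := norm_sub_le _ _
    linarith
  have hf : Integrable fun σ : ℝ => ((‖X τ - X σ‖ ^ 2 + q) ^ (3 / 2 : ℝ))⁻¹ • cross (deriv X σ) (X τ - X σ) :=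
    matchedBiotSavart_integrable (m := fun _ => q) hq (fun _ => le_rfl) continuous_const hc (hX.of_le (by norm_num))
      (fun u => (hunit u).le) hXg (X τ)
  exact integral_eq_zero_of_hasDerivAt_of_integrable (fun σ => hasDerivAt_selfIntegrand_param hq hX τ σ)
    (integrable_selfIntegrand_deriv_param hq hX hunit hc hchord hM τ) hf

/-! ## §3 The symmetrized form of the derivative strand -/

/-- **SYMMETRIZATION OF THE SELF-STRAND DERIVATIVE KERNEL**: for every direction `P`,
`∫ G(Xτ − Xσ, X′σ, P) dσ = ∫ [G(Xτ − Xσ, X′σ, P) + ∂_σ f(σ)] dσ`. [folklore] -/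
theorem selfStrand_derivKernel_symm {q : ℝ} (hq : 0 < q) (hX : ContDiff ℝ 2 X) (hunit : ∀ s, ‖deriv X s‖ = 1) {c M : ℝ}
    (hc : 0 < c) (hchord : ∀ u v, c * |u - v| ≤ ‖X u - X v‖) (hM : ∀ s, ‖deriv (deriv X) s‖ ≤ M) (τ : ℝ)
    (P : EuclideanSpace ℝ (Fin 3)) :
    ∫ σ : ℝ, ((-3 * ⟪X τ - X σ, P⟫_ℝ * ((‖X τ - X σ‖ ^ 2 + q) ^ (5 / 2 : ℝ))⁻¹) • cross (deriv X σ) (X τ - X σ) +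
        ((‖X τ - X σ‖ ^ 2 + q) ^ (3 / 2 : ℝ))⁻¹ • cross (deriv X σ) P) =
      ∫ σ : ℝ, (((-3 * ⟪X τ - X σ, P⟫_ℝ * ((‖X τ - X σ‖ ^ 2 + q) ^ (5 / 2 : ℝ))⁻¹) • cross (deriv X σ) (X τ - X σ) +
          ((‖X τ - X σ‖ ^ 2 + q) ^ (3 / 2 : ℝ))⁻¹ • cross (deriv X σ) P) +
        ((-3 * ⟪X τ - X σ, -deriv X σ⟫_ℝ * ((‖X τ - X σ‖ ^ 2 + q) ^ (5 / 2 : ℝ))⁻¹) • cross (deriv X σ) (X τ - X σ) +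
          ((‖X τ - X σ‖ ^ 2 + q) ^ (3 / 2 : ℝ))⁻¹ • (cross (deriv X σ) (-deriv X σ) + cross (deriv (deriv X) σ) (X τ - X σ)))) := by
  have hXg : ∀ u, c * |u| - ‖X 0‖ ≤ ‖X u‖ := fun u => by
    have h := hchord u 0
    rw [sub_zero] at h
    have h2 : ‖X u - X 0‖ ≤ ‖X u‖ + ‖X 0‖ := norm_sub_le _ _
    linarith
  have hG := (matchedBiotSavart_directionalDeriv (m := fun _ => q) hq (fun _ => le_rfl) continuous_const hc (hX.of_le (by norm_num))
    (fun u => (hunit u).le) hXg (X τ) P).1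
  rw [integral_add hG (integrable_selfIntegrand_deriv_param hq hX hunit hc hchord hM τ),
    integral_selfIntegrand_deriv_param_eq_zero hq hX hunit hc hchord hM τ, add_zero]

end Summit.NavierStokesRegularity.NavierStokesRegularity.Theorems.SkeletonJ1RFrame

end
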